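/-
Origin: expansion seat `prover-pub-hodgecm-mc-binder-2-g7-0`, handover #18 19:40Z md5 e66430045ee9 (148 l.; (J-omg) in KERNEL FORM on Fock-polynomial vectors: §1 `vacScalar_of_blocks_eq_smul_one` (`vacScalar e k = a^{∣P'∣e_P} b^{∣Q'∣e_Q} u^{∣R'∣e_R} u'^{∣S'∣e_S}` on a letter with scalar blocks), `vacScalar_of_W_blocks_eq_smul_one` (W-torus letter `((1,1),(u•1,u'•1))` ↦ `u^{∣R'∣e_R} u'^{∣S'∣e_S}`), `vacScalar_of_V_blocks_eq_smul_one`; §2 **`cmBlockRepAt_κ_tensorPi_binvPi`**: `ω′(s(κ k))(B⁻¹G ⊠ Φ₂) = vacScalar e_v k • (B⁻¹(linSubst (dualPairι k)⋆ G) ⊠ Φ₂)` (e_v = `placeVacExponents`, #17 + Folland's `unitaryOpPi_binvPi`), **`cmBlockRepAt_κ_tensorPi_binvPi_of_linSubst_eq_smul`** (eigenpolynomial `linSubst (dualPairι k)⋆ G = c • G` ⇒ eigenvalue `vacScalar e_v k * c` — the SHAPE OF `omg_ins`; the dictionaries #14/#15/#16 supply `c` for the printed vectors/letters), `cmArchWeilRep_κ_binvPi`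 (native frame); farm amalgam (3518 l.) rc 0 / 0 err / 0 warn / 0 proof-hole, `#print axioms cmArchWeilRep_κ_binvPi` = trio (`g7/certs/KappaEigen_amalg.json`)) (`HOME/mc/pub-hodgecm-mc-binder-2/g7/pkg/HodgeCM/Model/HypCensus/KappaEigen.lean`, md5 e6643004, 148 lines);
landed by the gen-13 packager (p-g13) in gate run 37 as `HodgeCM/Model/HypCensus/KappaEigen.lean` (verbatim).
-/
/-
Origin: speedrun cell pub-hodgecm, MODEL-CONSTRUCTION sub-cell, lineage mc-binder-2 (rows A12/A34 of the binder ledger: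
`hyp12` / `hyp34`), seat prover-pub-hodgecm-mc-binder-2-g7-0 (gen 7), 2026-08-19.  Target in PKG:
`HodgeCM/Model/HypCensus/KappaEigen.lean` (NEW additive leaf; imports this lineage's `PlaceExponents` and the K-1 twin
`Analysis/SegalBargmann/SchwartzBargmannIntertwining` (PRESENT in PKG)).  KERNEL only: 0 records / named facts / proof holes.
-/
import Summits.HodgeConjecture.HodgeCM.Model.HypCensus.PlaceExponents
import Literature.Analysis.SegalBargmann.SchwartzBargmannIntertwining

/-!
# Census kit (rows A12/A34), (J-omg) in kernel form: the compact group of the CM pin on Fock-polynomial vectors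

With `e_v := placeVacExponents …` (#17) and Folland's Bargmann intertwining `μ₀(U)(B⁻¹G) = B⁻¹(G ∘ U⁻¹)`
(`unitaryOpPi_binvPi`), the (J-arch) block datum `ω′` of the CM pin at a real place `v` acts on every vector
`B⁻¹G ⊠ Φ₂` (`G` a Fock polynomial in the variables of the place `v`, `Φ₂` anything at the other places) through the
compact group `K_V × K_W = (U(P') × U(Q')) × (U(R') × U(S'))` by

* **`cmBlockRepAt_κ_tensorPi_binvPi`**: `ω′(s(κ k)) (B⁻¹G ⊠ Φ₂) = vacScalar e_v k • (B⁻¹(linSubst (dualPairι k)⋆ G) ⊠ Φ₂)`;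
* **`cmBlockRepAt_κ_tensorPi_binvPi_of_linSubst_eq_smul`**: if `G` is a `linSubst (dualPairι k)⋆`-eigenpolynomial with
  eigenvalue `c` then `B⁻¹G ⊠ Φ₂` is an eigenvector of `ω′(s(κ k))` with eigenvalue `vacScalar e_v k * c` — the shape of the
  `omg_ins` clause of `HypSmoothSide` (the dictionaries #14/#15/#16 supply `c` for the printed vectors and letters);
* **`vacScalar_of_blocks_eq_smul_one`**: on a letter whose four blocks are the scalars `a, b, u, u'`,
  `vacScalar e k = a^{|P'| e_P} b^{|Q'| e_Q} u^{|R'| e_R} u'^{|S'| e_S}` — so on the `W`-torus letter `((1,1),(t₁,t₂))` of a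
  Σ₁₂ place (`|R'| = |S'| = 1`) the scalar is `t₁^{e_R} t₂^{e_S}`: the exponent pair the printed `pinnedVacs` must match
  (`VacReadOff`).

Nothing here is a claim of PerL/QW8.  Style lint (L-notation): no `local notation`.
-/

set_option autoImplicit false

noncomputable section

open Filter Topology
open NumberField NumberField.InfinitePlace IsDedekindDomain MeasureTheory
open scoped Matrix
open scoped Kronecker Classical TensorProduct ComplexConjugate
open Literature.NumberTheory.Automorphic Literature.NumberTheory.Automorphic.UnitaryGroup Literature.NumberTheory.Weil1964
open Literature.RepresentationTheory.HeisenbergGroup (polar Heisenberg symplecticGroup ofSymplectic)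
open Literature.RepresentationTheory.KonnoKonno2007 Literature.RepresentationTheory.KonnoKonno2007.RealDualPair
open Literature.NumberTheory.GelbartRogawski1991 Literature.NumberTheory.GelbartRogawski1991.UnitaryDualPair
open Literature.Analysis.SegalBargmann Literature.Analysis.Distribution

namespace HodgeCM.Model.HypCensus

/-! ## 1. The determinant-power scalar on scalar letters -/

section Scalar

variable {P' Q' R' S' : Type} [Fintype P'] [DecidableEq P'] [Fintype Q'] [DecidableEq Q'] [Fintype R'] [DecidableEq R']
  [Fintype S'] [DecidableEq S']

/-- **`vacScalar` on a letter with scalar blocks**: if the four blocks of `k ∈ K_V × K_W` are `a•1, b•1, u•1, u'•1` then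
`vacScalar e k = a^{|P'| e_P} · b^{|Q'| e_Q} · (u^{|R'| e_R} · u'^{|S'| e_S})`. [folklore] -/
theorem vacScalar_of_blocks_eq_smul_one (ev : VacExponents) {k : DPK P' Q' R' S'} {a b u u' : ℂ}
    (hP : ((k.1.1 : Matrix.unitaryGroup P' ℂ) : Matrix P' P' ℂ) = a • (1 : Matrix P' P' ℂ))
    (hQ : ((k.1.2 : Matrix.unitaryGroup Q' ℂ) : Matrix Q' Q' ℂ) = b • (1 : Matrix Q' Q' ℂ))
    (hR : ((k.2.1 : Matrix.unitaryGroup R' ℂ) : Matrix R' R' ℂ) = u • (1 : Matrix R' R' ℂ))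
    (hS : ((k.2.2 : Matrix.unitaryGroup S' ℂ) : Matrix S' S' ℂ) = u' • (1 : Matrix S' S' ℂ)) :
    vacScalar ev k =
      a ^ ((Fintype.card P' : ℤ) * ev.eP) * b ^ ((Fintype.card Q' : ℤ) * ev.eQ) *
        (u ^ ((Fintype.card R' : ℤ) * ev.eR) * u' ^ ((Fintype.card S' : ℤ) * ev.eS)) := by
  simp only [vacScalar, hP, hQ, hR, hS, Matrix.det_smul, Matrix.det_one, mul_one, ← zpow_natCast, ← zpow_mul]

/-- … in particular with trivial `V`-blocks: `vacScalar e ((1,1),(u•1,u'•1)) = u^{|R'| e_R} · u'^{|S'| e_S}`. [folklore] -/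
theorem vacScalar_of_W_blocks_eq_smul_one (ev : VacExponents) {k : DPK P' Q' R' S'} {u u' : ℂ} (hV : k.1 = 1)
    (hR : ((k.2.1 : Matrix.unitaryGroup R' ℂ) : Matrix R' R' ℂ) = u • (1 : Matrix R' R' ℂ))
    (hS : ((k.2.2 : Matrix.unitaryGroup S' ℂ) : Matrix S' S' ℂ) = u' • (1 : Matrix S' S' ℂ)) :
    vacScalar ev k = u ^ ((Fintype.card R' : ℤ) * ev.eR) * u' ^ ((Fintype.card S' : ℤ) * ev.eS) := by
  rw [vacScalar_of_blocks_eq_smul_one ev (a := 1) (b := 1) (by rw [hV]; simp) (by rw [hV]; simp) hR hS, one_zpow, one_zpow,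
    one_mul, one_mul]

/-- … and with trivial `W`-blocks: `vacScalar e ((a•1,b•1),(1,1)) = a^{|P'| e_P} · b^{|Q'| e_Q}`. [folklore] -/
theorem vacScalar_of_V_blocks_eq_smul_one (ev : VacExponents) {k : DPK P' Q' R' S'} {a b : ℂ}
    (hP : ((k.1.1 : Matrix.unitaryGroup P' ℂ) : Matrix P' P' ℂ) = a • (1 : Matrix P' P' ℂ))
    (hQ : ((k.1.2 : Matrix.unitaryGroup Q' ℂ) : Matrix Q' Q' ℂ) = b • (1 : Matrix Q' Q' ℂ)) (hW : k.2 = 1) :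
    vacScalar ev k = a ^ ((Fintype.card P' : ℤ) * ev.eP) * b ^ ((Fintype.card Q' : ℤ) * ev.eQ) := by
  rw [vacScalar_of_blocks_eq_smul_one ev hP hQ (u := 1) (u' := 1) (by rw [hW]; simp) (by rw [hW]; simp), one_zpow, one_zpow,
    one_mul, mul_one]

end Scalar

/-! ## 2. The compact group of the CM pin on Fock-polynomial vectors -/

section CMPin

variable (L : Type) [Field L] [NumberField L] [IsCMField L] {N M n : ℕ} (e : Fin N × Fin M ≃ Fin n)
variable (dV : Fin N → L) (hdV : ∀ i, IsCMField.complexConj L (dV i) = dV i) (hdV0 : ∀ i, dV i ≠ 0)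
variable (dW : Fin M → L) (hdW : ∀ i, IsCMField.complexConj L (dW i) = dW i) (hdW0 : ∀ i, dW i ≠ 0)
variable (hGR : (cmSplittingDatum L e dV hdV hdV0 dW hdW hdW0).CompatibleSplitting) (ι₁ : L →+* ℂ)
variable (v : {v : InfinitePlace ↥(maximalRealSubfield L) // v.IsReal})
variable {P' Q' R' S' : Type} [Fintype P'] [DecidableEq P'] [Fintype Q'] [DecidableEq Q'] [Fintype R'] [DecidableEq R']
  [Fintype S'] [DecidableEq S']
variable (eP : PosIdx (cmXV L dV hdV ι₁ v) ≃ P') (eQ : NegIdx (cmXV L dV hdV ι₁ v) ≃ Q')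
  (eR : PosIdx (cmXW L dV dW hdW ι₁ v) ≃ R') (eS : NegIdx (cmXW L dV dW hdW ι₁ v) ≃ S')
variable
  (hsign : (∃ i₀ : Fin N, (∀ i, i ≠ i₀ → 0 < (ι₁ (dV i)).re) ∨ ∀ i, i ≠ i₀ → (ι₁ (dV i)).re < 0) ∧
    ((∀ j, 0 < (ι₁ (dW j)).re) ∨ ∀ j, (ι₁ (dW j)).re < 0) ∧
    (∀ τ : L →+* ℂ, InfinitePlace.mk τ ≠ InfinitePlace.mk ι₁ → (∀ i, 0 < (τ (dV i)).re) ∨ ∀ i, (τ (dV i)).re < 0) ∧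
    (∀ τ : L →+* ℂ, InfinitePlace.mk τ ≠ InfinitePlace.mk ι₁ →
      (∃ j₀ : Fin M, ∀ j, j ≠ j₀ → 0 < (τ (dW j)).re) ∨ ∀ j, (τ (dW j)).re < 0))
  (hslot : ∃ ω₁ : Representation ℂ (Ginf P' Q' R' S') (SchwartzMap (DPIdx P' Q' R' S' → ℝ) ℂ),
    IsArchWeilDatum (ι𝕎 P' Q' R' S') ω₁ ∧ ∀ u, Continuous (ω₁ u))

/-- **(J-omg), kernel form.** `ω′(s(κ k)) (B⁻¹G ⊠ Φ₂) = vacScalar e_v k • (B⁻¹(linSubst (dualPairι k)⋆ G) ⊠ Φ₂)` for every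
`k ∈ K_V × K_W`, every Fock polynomial `G` at the place `v` and every `Φ₂`. [Folland1989, Prop. (4.39); KonnoKonno2007, Lemma 5.2] -/
theorem cmBlockRepAt_κ_tensorPi_binvPi (k : DPK P' Q' R' S') (G : MvPolynomial (DPIdx P' Q' R' S') ℂ)
    (Φ₂ : SchwartzMap (Fin n × {w : {w : InfinitePlace ↥(maximalRealSubfield L) // w.IsReal} // w ≠ v} → ℝ) ℂ) :
    cmBlockRepAt L e dV hdV hdV0 dW hdW hdW0 hGR ι₁ v eP eQ eR eS
        (cmBlockSectionAt L dV hdV hdV0 dW hdW hdW0 ι₁ v eP eQ eR eS (κ P' Q' R' S' k)) (tensorPi (binvPi G) Φ₂) =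
      vacScalar (placeVacExponents L e dV hdV hdV0 dW hdW hdW0 hGR ι₁ v eP eQ eR eS hsign hslot) k •
        tensorPi (binvPi (linSubst (star ((dualPairι k : Matrix.unitaryGroup (DPIdx P' Q' R' S') ℂ) :
          Matrix (DPIdx P' Q' R' S') (DPIdx P' Q' R' S') ℂ)) G)) Φ₂ := by
  rw [cmBlockRepAt_κ_tensorPi_placeVacExponents, κOp, _root_.smul_apply, unitaryOpPi_binvPi, tensorPi_smul_left]

/-- **(J-omg), eigenvector form** (the shape of the `omg_ins` clause): if `linSubst (dualPairι k)⋆ G = c • G` then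
`ω′(s(κ k)) (B⁻¹G ⊠ Φ₂) = (vacScalar e_v k * c) • (B⁻¹G ⊠ Φ₂)`. [Folland1989, Prop. (4.39)] -/
theorem cmBlockRepAt_κ_tensorPi_binvPi_of_linSubst_eq_smul (k : DPK P' Q' R' S') {G : MvPolynomial (DPIdx P' Q' R' S') ℂ}
    {c : ℂ} (hG : linSubst (star ((dualPairι k : Matrix.unitaryGroup (DPIdx P' Q' R' S') ℂ) :
      Matrix (DPIdx P' Q' R' S') (DPIdx P' Q' R' S') ℂ)) G = c • G)
    (Φ₂ : SchwartzMap (Fin n × {w : {w : InfinitePlace ↥(maximalRealSubfield L) // w.IsReal} // w ≠ v} → ℝ) ℂ) :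
    cmBlockRepAt L e dV hdV hdV0 dW hdW hdW0 hGR ι₁ v eP eQ eR eS
        (cmBlockSectionAt L dV hdV hdV0 dW hdW hdW0 ι₁ v eP eQ eR eS (κ P' Q' R' S' k)) (tensorPi (binvPi G) Φ₂) =
      (vacScalar (placeVacExponents L e dV hdV hdV0 dW hdW hdW0 hGR ι₁ v eP eQ eR eS hsign hslot) k * c) •
        tensorPi (binvPi G) Φ₂ := by
  rw [cmBlockRepAt_κ_tensorPi_binvPi L e dV hdV hdV0 dW hdW hdW0 hGR ι₁ v eP eQ eR eS hsign hslot, hG, binvPi_smul,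
    tensorPi_smul_left, smul_smul]

/-- **(J-omg), native frame**: `ω_∞(s(κ k)) F⁻¹(B⁻¹G ⊠ Φ₂) = vacScalar e_v k • F⁻¹(B⁻¹(linSubst (dualPairι k)⋆ G) ⊠ Φ₂)`.
[Folland1989, Prop. (4.39); KonnoKonno2007, Lemma 5.2] -/
theorem cmArchWeilRep_κ_binvPi (k : DPK P' Q' R' S') (G : MvPolynomial (DPIdx P' Q' R' S') ℂ)
    (Φ₂ : SchwartzMap (Fin n × {w : {w : InfinitePlace ↥(maximalRealSubfield L) // w.IsReal} // w ≠ v} → ℝ) ℂ) :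
    cmArchWeilRep L e dV hdV hdV0 dW hdW hdW0 hGR
        (cmBlockSectionAt L dV hdV hdV0 dW hdW hdW0 ι₁ v eP eQ eR eS (κ P' Q' R' S' k))
        ((cmBlockFrameAt L e dV hdV hdV0 dW hdW hdW0 ι₁ v eP eQ eR eS).symm (tensorPi (binvPi G) Φ₂)) =
      vacScalar (placeVacExponents L e dV hdV hdV0 dW hdW hdW0 hGR ι₁ v eP eQ eR eS hsign hslot) k •
        (cmBlockFrameAt L e dV hdV hdV0 dW hdW hdW0 ι₁ v eP eQ eR eS).symm
          (tensorPi (binvPi (linSubst (star ((dualPairι k : Matrix.unitaryGroup (DPIdx P' Q' R' S') ℂ) :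
            Matrix (DPIdx P' Q' R' S') (DPIdx P' Q' R' S') ℂ)) G)) Φ₂) := by
  rw [cmArchWeilRep_eq_symm_cmBlockRepAt L e dV hdV hdV0 dW hdW hdW0 hGR ι₁ v eP eQ eR eS,
    ContinuousLinearEquiv.apply_symm_apply, cmBlockRepAt_κ_tensorPi_binvPi L e dV hdV hdV0 dW hdW hdW0 hGR ι₁ v eP eQ eR eS
      hsign hslot, map_smul]

end CMPin

end HodgeCM.Model.HypCensus

end
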